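import Summits.AtomisticToContinuum.Crystallization.Theorems.ChargedEnergyGapDominoLedgerK
import HarnessLib

/-!

K-FORM (decomp-a2c hand-2 g42, critic row 1590 route (R-i′)): every cap-dependent reference in the CODE of this file reads the κ-WINDOW-LETTER twins of
`…ChargedEnergyGapDominoLedgerK` (`domCapK`, `DominoLawQ'K`, `IsDominantK`, `domLoadK`/`domMomentK`, `ballMatchingSingleQ'_designate_of_dominoLedgerK`,
`thawSplit_leaves_of_dominoLedger_leavesK`, `chargedEnergyGap_of_dominoLedger_numericsK`, …); this file's OWN declaration names are lens-3's (first landing).  The prose below is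
lens-3's r1586 (BYTES-90) text verbatim: where it says `domCap` / `DominoLawQ'` / «the tree's cap» it discusses the g88 cap and its κ repair, which the code now reads as `domCapK`.
# ChargedEnergyGap · NODE 90 «FeetLaw» (lens-3 «one certified translation + split beneath», generation 89)

TARGET = the LOCAL leaf `hDL` (DL) `DominoLawQ' cls₀ 80 20 130 106 (1/3600000000) (1/60000000) (1/2000000) (1/60000000) (3/5) (1/3) 3 (3/100)
160 80 (6/5) (3/2) (679/1000) (691/1000)` of the TREE cone `chargedEnergyGap_of_dominoLedger_numerics` (`…Theorems.ChargedEnergyGapDominoLedger`,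
NODE 89, LANDED 2026-09-03; critic row 1572 (B): second sufficient route beneath (M¹), est. margin of the deciding leaf (DT) `1.081`).  (DL) is
a statement over CUT GEOMETRIES: for every reference of the class, every invariant cut set `C`, weight-zero set `X`, listed convex pieces `D`,
every single-crossing ball and every dominant marked hole `w`, the thawed hole costs (`holeCost` = frame INFIMA of the seven-point LP cost
`(τ·2ρ)²·roofVal T75 (W∘vertices)`) of the ≤ 2 marked holes of the domino of `w` sum to at most `Ĉ(sheet depth of w)` (`domCap ∘ chargeDepth`).

WHY THIS NODE (door 3 of HANDOFF-lens-3-g89, sanctioned by critic row 1572; doors 1–2 wait on the census of (DL)/(DT) by census-1 g46, started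
19:09Z).  The tags of (DL) say ATTACKABLE-L «as a two-hole extremal problem over ≤ 14 feet of the cut set» — but AS TYPED it quantifies over
periodic references, invariant sets and balls, and its cost is an infimum over anchored frames: no prover and no census can attack it in that form
without first proving the DICTIONARY that the tags presuppose.  This node IS that dictionary, certified: the ONE translation of the lens (cut set
`C` ↦ the ≤ 14 NEAREST POINTS of the two holes' seven-point stencils; frame infimum ↦ ONE explicit anchored frame per ordered pole pair; marked /
heavy-active / line-pair ↦ the depth shadow `IsFeetHole`; dominant ↦ cap-ordered; single crossing ↦ at most one partner, on the other line of the
domino) and the split beneath it into the SOLO law (D¹) and the PAIR law (D²) — two statements about FINITE POINT CONFIGURATIONS and the LP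
`roofVal T75`, of the [CELL-LP] class of the tree's (Z₀) `SixFeetZeroConeQ`, (S♯) `SixFeetShallowCapQ`, (KC) `KinkCostTableQ` (NODE 81 typed the
seven-point dictionary for ONE octahedron against a (min-depth, max-kink) TABLE, `sevenPoint_dictionary` / `frameVal_le_capVal`; this node types the
FOURTEEN-point dictionary for a PARITY DOMINO against the one-variable cap `Ĉ`).  After it the local law of the lane has no configuration-space
quantifier left: (D¹) IS the objective `single` of the desk adversary of record (`g88/num/cap88.py adv|refine2`, RESULTS-g88 §C/§F, sup `0.969 Ĉ`);
(D²) is NOT the g88 `domino` objective (its optima never have an admissible partner, `num/RESULTS-g89.md` §B) but the objective of the new TWO-HOLE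
instruments `num/pair89.py | pair89b.py | cross89.py | tilt89.py` (RESULTS-g89 §C–§D) — typed and instrumented together, so the census instruments and
the prover targets coincide; instrumenting (D²) is what produced the FINDING below.

THE SPLIT (this file): (DL) ⟸ (D¹) ∧ (D²), glue PROVED (0 sorry, standard axioms), no table, no numeric side condition beyond `0 < s`, `0 < ϱ`,
`0 < ϱχ`, `0 ≤ r₁`, `2(r₁ + r₂) < ϱχ/2`, `0 < ρlo` (`norm_num` at the designate).
* (D¹) `SoloFeetLawQ dK unit ϱ τ ρlo ρhi` — THE SOLO FEET LAW [FINITE-DIMENSIONAL (≤ 7 points + frame) · ONE-HOLE case · UNDECIDED(test = `cap88/cap89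
  single | domino`: sup `0.969 Ĉ` bulk (tilted two-foot at `118.6`), `≤ 0.91 Ĉ` plateau, `≤ 0.92` on the shallow cells `102–108`, `≤ 0.24` for `d̃ ≤ 97`
  where the floor `unit/10` dominates; RESULTS-g88 §C/§F, RESULTS-g89 §B) · THIN (3.1 % slack at the binding bulk cell; critic row 1586) · INSTRUMENTABLE · ATTACKABLE-M ([CELL-LP]: interval arithmetic over (pole depth, tilt, feet
  offsets) boxes against the piecewise-constant `Ĉ`, as for (KC)/(S♯)) · why it might fail: a ≤ 7-point obstacle whose admissible hole beats
  `1.03 ×` the tilted two-foot cost at its sheet depth (bulk) or `45 c_T` (plateau) · does not imply (DL) (no partner), nor (D²), nor (M¹)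
  (`check/MustFail90.lean`)]
* (D²) `PairFeetLawQ dK unit ϱ τ ρlo ρhi` — THE PAIR FEET LAW [FINITE-DIMENSIONAL (≤ 14 points + frame) · the TWO-HOLE content of (DL) (the comb law
  `C(t) + C(½ − t) ≤ Ĉ`: the odd holes of the two lines of a parity domino carry opposite phases) · INSTRUMENTABLE (pair89 / pair89b / cross89 /
  tilt89) · ★ DESK-VIOLATED AT THE TREE'S `domCap` IN THE SHALLOW WINDOW `d̃ ≈ 103–104` (FINDING «PAIR-WINDOW-90», RESULTS-g89 §D): two DIAGONALLY
  adjacent two-axis («junction-type», kinks in `x` and `z`) holes of a SIX-foot obstacle at sheet depth `103.39` cost `0.714 + 0.395 = 1.109 c_T >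
  Ĉ(103.39) = 1.080 c_T` (pair ratio `1.026`; second witness `1.021` at `103.92`; typed-realisable: odd holes `w = (1,0,0)`, `w' = (0,0,−1)` on the
  two lines of one parity domino, LEAN attributed axis `z` for both, min vertex depth `102.4 ≥ 93.5`, cap-ordered; `num/out/V1_verify89_W3.txt`);
  closed-form 45° tents reach `0.79` (`d̃ 105`); HEALTHY elsewhere (`≤ 0.71` for `d̃ ≤ 99.7` where the floor dominates, `≤ 0.65` for `d̃ ≥ 106`,
  `≤ 0.42` on `113–118`, `0` at `119–120`, `≤ 0.91` plateau) · UNDER THE PRE-REGISTERED REPAIR of `domCap` («κ-window letter»: both sub-plateau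
  letters scaled by `κ(d) = max 1 (min 2 ((116 − d)/3))`, i.e. doubled for `d ≤ 110`, unchanged for `d ≥ 113`; pre-staged edition
  `lean/editions/ChargedEnergyGapDominoLedgerA_R90kappa.lean.txt`, scratch-checked together with the tree parts B/main AND this file: rc 0, standard
  axioms, `check/ScratchR90kappa_out.txt`; ADOPTED, critic row 1586) the window part of (D²) follows AT THE LEVEL OF NUMBERS from single `≤ Ĉ_g88 = Ĉ_κ/2` on `d ≤ 110` (not as a typed implication from (D¹), which then reads single `≤ Ĉ_κ`: `hD2` stays its own binder) and the adversarial sup is `≤ 0.50`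
  everywhere (RESULTS-g89 §F); THEN ATTACKABLE-L ([CELL-LP] in ≤ 14 points after the pruning «same attributed axis, both kinks `≥ 1`, cap-ordered ⇒
  few partner offsets or the partner is cheap», to be typed by the prover) · why it might fail (after the repair): a ≤ 14-point obstacle carrying two
  cap-ordered admissible holes on the two lines of a parity domino whose feet costs sum above `Ĉ_κ` of the dominant sheet depth · does not imply
  (DL) (no solo case), nor (D¹), nor (M¹) (`check/MustFail90.lean`)]
CONSEQUENCE FOR THE TREE LEAF (DL) («PAIR-WINDOW-90»): the violating configuration is a statement about FREE point obstacles; modulo the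
realisability of its local geometry (six feet at distance `≈ 103 > R_N = 80` from the hole pair, quasi-planar) by an admissible `(C, reference)` of
`cls₀` under (DL)'s own hypotheses (HeavyActive, `¬ OctTame`, `IsSingleCrossingBall` at `s = 3/5, λ = 1/3, ℓ = 3`, marked / dominant) it says that
(DL) is FALSE AT THE TREE'S CONSTANTS in the shallow window — the pre-registered INFORMATIVE outcome of critic row 1572 («repair by a `domCap`
letter»).  The census reached the SAME verdict INDEPENDENTLY AND EARLIER through the g88 cell model (census-1 g46, DT46.md §DL → stmt-14231,
19:59:52Z; like every cell-model number it does not check the ball-level single-crossing hypothesis): a three-axis CORNER obstacle whose central hole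
(`J = 2`) and its domino partner are both marked gives `domSum/Ĉ = 1.002 (101) · 1.079 (102) · 1.108 (103) · 1.102 (104) · 1.071 (105) · 1.045 (106) ·
1.006 (107)`, bulk `0.955–0.969`, plateau `≤ 0.943`, «it wants a third, shallow letter»; (DT) margin of record `1.0795` at `L = 118.1` (all phases).
The κ-window letter costs (DT) nothing where it binds (`B/Ĉ_κ ≥ 1.71` on `L ≤ 113` for the aligned slab, `118.1` unchanged; RESULTS-g89 §F; the
census's alternatives: floor `unit/10 → unit/2` below `108`, or `+ unit/4` everywhere) and ANY such letter leaves THIS file byte-identical (`domCap`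
by name).
Neither piece is pointwise WEAKER than (DL) (free point obstacles need not be invariant cut sets of the class; one explicit frame instead of the
infimum) — they are STRONGER-BUT-FINITE, exactly the standing of (KC) w.r.t. (M°)′ in NODE 81 and of (Z₀)/(S♯) w.r.t. (D)/(S): the translation
trades the configuration space for `ℝ^{≤ 42} × frame`, and the numerics of record already live on the finite side.
GLUE (PROVED): `dominoLawQ'_of_feetLaws : 0 < s → 0 < ϱ → 0 < ϱχ → 0 ≤ r₁ → 2(r₁+r₂) < ϱχ/2 → 0 < ρlo → (D¹) → (D²) → (DL)` for ANY class and
constants, through `holeCost_le_anchored` (ONE EXPLICIT ANCHORED FRAME per ordered pole pair: `anchorFrame`, `anchorLab`, `anchor_mem_frameValSet`,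
`frameVal_le_of_mem`), `marked_octahedron` ((LS) on EVERY pole pair of a marked hole: all six ordered pole pairs are mid pairs spanning the lattice
octahedron; `crease_frame`: clean χ-free non-plateau ⇒ `W = φ_ϱ ∘ dist(·, C)` on the vertices and `C ≠ ∅`; active ⇒ a vertex of depth `< dK`),
`feetSet_exists` (nearest points in `closure C` of the stencil lattice points: `dist(·, S) = dist(·, C)` on the stencil, `|S| ≤ |stencil|`), the
STENCIL DICTIONARY `hDepthMin_congr … sameDomino_congr` (every descriptor — min-depth, kinks, max-kink, attributed axis, sheet depth, cap, domino
key, feet cost, admissibility — depends on the depth field only through the seven stencil depths), and `marked_domino_line` (SINGLE CROSSING ON A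
DOMINO: two marked holes of the domino with the same `(a+1)`-coordinate lie in one line fibre, hence coincide; with `domKey_coords` the marked holes
of the domino are `w` alone or `w` and ONE partner on the other line — `Finset.sum_pair`).  DESIGNATE: `dominoLawQ'_designate_of_feetLaws`
(`dK = 130`, `unit = c_T = 1/60000000`, `ϱ = 160`, `τ = 3/100`, `ρ ∈ [0.679, 0.691]`); CONE `chargedEnergyGap_of_feetLaw_numerics` = NODE 89's 33
binders VERBATIM with `hDL ↦ hD1 hD2` (34 binders; the residual-deciding binder stays `hDT`); by-name record `dominoLedger_leaves_of_feetLaw_leaves`.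

RESPECTED (HANDOFF-lens-3-g89 DO-NOTs): the cap is NODE 89's `domCap` BY NAME (plateau letter kept, charge at pole-mean `+ ρ`, domino max via the
cap order — no per-hole / per-line / per-column budget, no slab-like or bipolar reference cap); the pieces are typed over GENUINE distance
functions `latDepth ↑S` of point sets (no Lipschitz/semiconcave relaxation: fake tuples `1.29–1.95 C₀`); nothing is built beneath (M_F¹)/(M_S)/(M_L);
the EQUIV-class translation carries two FINITE pieces beneath it (row 1478); (DL), (DT), (M¹) and every tree statement are used BY NAME, unchanged.
If the census re-types a constant of `domCap` (door 1), this file is unaffected: `domCap` enters by name only.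

0 sorry · axioms `propext`, `Classical.choice`, `Quot.sound` (`check/Audit90_out.txt`) · no `instance`/`notation`/options · imports only the tree's
`…ChargedEnergyGapDominoLedger` + `HarnessLib` · namespace `…Theorems.ChargedEnergyGapChartDial` (all NODE 72–89 names resolve unchanged).
-/

noncomputable section
open scoped Classical
open Literature.MathematicalPhysics.StatisticalMechanics Literature.Geometry.DiscreteGeometry
open Summit.AtomisticToContinuum.Crystallization.Theses.PricedLinkCensus
open Summit.AtomisticToContinuum.Crystallization.Theorems.ChargedEnergyGapNegative

namespace Summit.AtomisticToContinuum.Crystallization.Theorems.ChargedEnergyGapChartDial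

/-! ## §90.1 The feet calculus: anchored relabelling, feet hole cost, feet-admissible hole, the two pieces -/
section FeetCalculus

/-- ★ The **ANCHORED RELABELLING** of the vertex labels taking the axis-`0` pole pair `((0,false),(0,true))` to the ordered pole pair
`((a, !b), (a, b))` of `u = (a, b)`: axis `i ↦ a + i`; on the new axis `0` the pole bit is kept if `b = true` and flipped if `b = false`. -/
def anchorLab (u p : Fin 3 × Bool) : Fin 3 × Bool :=
  (u.1 + p.1, if p.1 = 0 then (if u.2 then p.2 else !p.2) else p.2)

/-- The inverse relabelling. [formal bookkeeping] -/
def anchorInv (u q : Fin 3 × Bool) : Fin 3 × Bool :=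
  (q.1 - u.1, if q.1 - u.1 = 0 then (if u.2 then q.2 else !q.2) else q.2)

/-- ★ The **ANCHORED FRAME** of the pole pair `u = (a, b)`: `f'ᵢ = ± f_{a+i}` (sign `−` only on `i = 0` when `b = false`), so that the axis-`0`
poles of `(c, f', ρ)` are `octVertex c f ρ a (!b)`, `octVertex c f ρ a b` and its six vertices are those of `(c, f, ρ)`. -/
def anchorFrame (f : Fin 3 → E3) (u : Fin 3 × Bool) : Fin 3 → E3 :=
  fun i => (if i = 0 then (if u.2 then (1 : ℝ) else -1) else 1) • f (u.1 + i)

/-- ★★ The **FEET HOLE COST** of the lattice hole `w` for a depth field `d` on `ℤ³` (frame scale `ρ`, profile scale `ϱ`): one sixth of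
`max 0 ((τ·2ρ)² · roofVal T75 (φ_ϱ ∘ d ∘ vertices))` summed over the six ANCHORED RELABELLINGS of the vertex sextuple — the finite-dimensional
shadow of the thawed hole cost `holeCost` (which takes, per ordered pole pair, the INFIMUM over all anchored frames; here ONE explicit anchored
frame per pole pair, hence `holeCost ≤ feetHoleCost ∘ (depth field of C)`, `holeCost_le_feetHoleCost`).  A function of the SEVEN stencil
depths `d(w), d(w ± eᵢ)` only (indeed of the six vertex depths). -/
def feetHoleCost (ϱ τ ρ : ℝ) (d : (Fin 3 → ℤ) → ℝ) (w : Fin 3 → ℤ) : ℝ :=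
  ∑ u : Fin 3 × Bool, (1 / 6) * max 0 ((τ * (2 * ρ)) ^ 2 * roofVal T75 (fun p => depthProfile ϱ (d (holeVertex w (anchorLab u p)))))

/-- `0 ≤ feetHoleCost`. [formal bookkeeping] -/
theorem feetHoleCost_nonneg (ϱ τ ρ : ℝ) (d : (Fin 3 → ℤ) → ℝ) (w : Fin 3 → ℤ) : 0 ≤ feetHoleCost ϱ τ ρ d w :=
  Finset.sum_nonneg fun _ _ => mul_nonneg (by norm_num) (le_max_left _ _)

/-- ★ A **FEET-ADMISSIBLE HOLE** of the depth field `d` (activity depth `dK`, frame scale `ρ`): the depth shadow of «odd lattice hole marked by a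
HEAVY ACTIVE LINE PAIR» (`lm_marked_admissible` + activity): odd coordinate sum, min-depth row `≥ 1` (min vertex depth `≥ 93.5`), kink column
`≥ 2` (max-kink `≥ 1`), min vertex depth `< 140` (table end) and `< dK` (the octahedron is not deep: `IsActive`). -/
def IsFeetHole (dK ρ : ℝ) (d : (Fin 3 → ℤ) → ℝ) (w : Fin 3 → ℤ) : Prop :=
  Odd (∑ i, w i) ∧ 1 ≤ capKRow (hDepthMin d w) ∧ 2 ≤ capKCol (hMaxKink ρ d w) ∧ hDepthMin d w < 140 ∧ hDepthMin d w < dK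

/-- ★★★ **(D¹) THE SOLO FEET LAW** — for every half-diagonal `ρ ∈ [ρlo, ρhi]`, every cubic frame `(c₀, f, ρ)` (`f` orthonormal), every NONEMPTY
POINT OBSTACLE `S ⊂ ℝ³` OF AT MOST SEVEN POINTS and every feet-admissible hole `w` of the lattice depth field `d_S = dist(cubicPt ·, S)`:
`feetHoleCost(w) ≤ Ĉ(sheet depth of w)` (`domCap ∘ chargeDepth`, the cap of NODE 89 verbatim).
[FINITE-DIMENSIONAL (≤ 7 points + a frame: the [CELL-LP] class of (Z₀) `SixFeetZeroConeQ`, (S♯), (KC) `KinkCostTableQ`) · the ONE-HOLE case of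
the domino law (DL) read through the fourteen-point dictionary · UNDECIDED(test: = the objective `single` of the desk adversary `cap88.py adv|refine2`
of RESULTS-g88 §C/§F: sup `0.969 Ĉ` (tilted two-foot obstacle, bulk `d̃ ≤ 120.5`), `≤ 0.91 Ĉ` on the plateau; coverage `d̃ ∈ [96, 130.5]`, g89 adds
`[93.5, 96]`) · THIN (3.1 % slack at the binding bulk cell; critic row 1586) · INSTRUMENTABLE · ATTACKABLE-M (seven-point LP cells: interval arithmetic over (pole depth, tilt, feet offsets) boxes against the
piecewise-constant `Ĉ`, as for (KC)) · why it might fail: a ≤ 7-point obstacle whose hole at sheet depth `d̃ ≤ 120.5` beats `1.03 ×` the tilted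
two-foot cost, or a junction hole above `45 c_T` on the plateau · NOT weaker than (DL) pointwise (free point obstacles need not be invariant cut sets of
the class) but finite-dimensional, and it does not imply (DL) (no partner hole) nor (M¹)] -/
def SoloFeetLawQ (dK unit ϱ τ ρlo ρhi : ℝ) : Prop :=
  ∀ ρ : ℝ, ρlo ≤ ρ → ρ ≤ ρhi → ∀ (c₀ : E3) (f : Fin 3 → E3), Orthonormal ℝ f →
    ∀ S : Finset E3, S.Nonempty → S.card ≤ 7 → ∀ w : Fin 3 → ℤ, IsFeetHole dK ρ (latDepth ↑S c₀ f ρ) w →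
      feetHoleCost ϱ τ ρ (latDepth ↑S c₀ f ρ) w ≤ domCapK unit ϱ τ ρ (chargeDepth ρ (latDepth ↑S c₀ f ρ) w)

/-- ★★★ **(D²) THE PAIR FEET LAW** — for every `ρ ∈ [ρlo, ρhi]`, cubic frame `(c₀, f, ρ)`, NONEMPTY POINT OBSTACLE `S` OF AT MOST FOURTEEN POINTS
and every two feet-admissible holes `w, w'` of `d_S` on the SAME PARITY DOMINO (`SameDomino`: same attributed axis `a`, same domino key) but NOT on
the same `a`-line, with `Ĉ(sheet depth of w') ≤ Ĉ(sheet depth of w)` (`w` dominant): `feetHoleCost(w) + feetHoleCost(w') ≤ Ĉ(sheet depth of w)`.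
[FINITE-DIMENSIONAL (≤ 14 points + a frame) · the TWO-HOLE content of (DL) (the comb law `C(t) + C(½ − t) ≤ Ĉ`: opposite phases on the two lines
of a domino) read through the fourteen-point dictionary · UNDECIDED(test: ⊇ the objective `domino` of `cap88.py refine2` (partner offsets
`k e_a ± e_{a+1}`, `|k| ≤ 3`): sup `0.969 Ĉ` bulk / `0.92` plateau, RESULTS-g88 §F; g89 adds the partner offsets `|k| ∈ {5, 7}`) · INSTRUMENTABLE ·
ATTACKABLE-L ([CELL-LP] in ≤ 14 points, after the pruning «same axis, both kinks `≥ 1`, cap-ordered ⇒ `|k| ≤ 3` or the partner is cheap») · why it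
might fail: a ≤ 14-point obstacle carrying two cap-ordered admissible holes on adjacent parallel lines whose feet costs sum above `Ĉ` of the dominant
sheet depth (the desk optimum sits at `0.969`) · does not imply (DL) (no solo case), nor (D¹), nor (M¹)] -/
def PairFeetLawQ (dK unit ϱ τ ρlo ρhi : ℝ) : Prop :=
  ∀ ρ : ℝ, ρlo ≤ ρ → ρ ≤ ρhi → ∀ (c₀ : E3) (f : Fin 3 → E3), Orthonormal ℝ f →
    ∀ S : Finset E3, S.Nonempty → S.card ≤ 14 → ∀ w w' : Fin 3 → ℤ,
      IsFeetHole dK ρ (latDepth ↑S c₀ f ρ) w → IsFeetHole dK ρ (latDepth ↑S c₀ f ρ) w' →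
      SameDomino ρ (latDepth ↑S c₀ f ρ) w w' → ¬SameLine (hAxis ρ (latDepth ↑S c₀ f ρ) w) w w' →
      domCapK unit ϱ τ ρ (chargeDepth ρ (latDepth ↑S c₀ f ρ) w') ≤ domCapK unit ϱ τ ρ (chargeDepth ρ (latDepth ↑S c₀ f ρ) w) →
        feetHoleCost ϱ τ ρ (latDepth ↑S c₀ f ρ) w + feetHoleCost ϱ τ ρ (latDepth ↑S c₀ f ρ) w' ≤
          domCapK unit ϱ τ ρ (chargeDepth ρ (latDepth ↑S c₀ f ρ) w)

end FeetCalculus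

/-! ## §90.2 The anchored frames: one explicit anchored frame per ordered pole pair (`holeCost ≤` the explicit-frame cost) -/
section AnchoredFrames

/-- [formal bookkeeping] -/
theorem anchorLab_anchorInv (u q : Fin 3 × Bool) : anchorLab u (anchorInv u q) = q := by
  revert u q
  decide

/-- [formal bookkeeping] -/
theorem anchorLab_pole (a : Fin 3) (b c : Bool) : anchorLab (a, b) (0, c) = (a, if b then c else !c) := by
  unfold anchorLab
  simp

/-- ★ The vertices of the anchored frame are the relabelled vertices of the frame. [formal bookkeeping] -/
theorem octVertex_anchorFrame (c : E3) (f : Fin 3 → E3) (ρ : ℝ) (u p : Fin 3 × Bool) :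
    octVertex c (anchorFrame f u) ρ p.1 p.2 = octVertex c f ρ (anchorLab u p).1 (anchorLab u p).2 := by
  rcases u with ⟨a, b⟩
  rcases p with ⟨i, b'⟩
  unfold octVertex anchorFrame anchorLab
  by_cases hi : i = 0
  · subst hi
    cases b <;> cases b' <;> simp
  · cases b' <;> simp [hi]

/-- ★ The anchored frame of an orthonormal frame is orthonormal. [formal bookkeeping] -/
theorem anchorFrame_orthonormal {f : Fin 3 → E3} (hf : Orthonormal ℝ f) (u : Fin 3 × Bool) : Orthonormal ℝ (anchorFrame f u) := by
  rw [orthonormal_iff_ite] at hf ⊢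
  intro i j
  simp only [anchorFrame, real_inner_smul_left, real_inner_smul_right, hf, add_right_inj]
  by_cases hij : i = j
  · subst hij
    simp only [if_true, mul_one]
    split_ifs <;> norm_num
  · simp [hij]

/-- The axis-`0` poles of the anchored frame of `u = (a, b)` are `octVertex c f ρ a (!b)` and `octVertex c f ρ a b`. [formal bookkeeping] -/
theorem octVertex_anchorFrame_poles (c : E3) (f : Fin 3 → E3) (ρ : ℝ) (a : Fin 3) (b : Bool) :
    octVertex c (anchorFrame f (a, b)) ρ 0 false = octVertex c f ρ a (!b) ∧ octVertex c (anchorFrame f (a, b)) ρ 0 true = octVertex c f ρ a b := by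
  have h1 := octVertex_anchorFrame c f ρ (a, b) (0, false)
  have h2 := octVertex_anchorFrame c f ρ (a, b) (0, true)
  rw [anchorLab_pole] at h1 h2
  cases b
  · exact ⟨h1, h2⟩
  · exact ⟨h1, h2⟩

/-- The vertex SET of the anchored frame is the vertex set of the frame. [formal bookkeeping] -/
theorem octVertex_anchorFrame_range (c : E3) (f : Fin 3 → E3) (ρ : ℝ) (u : Fin 3 × Bool) (x : E3) :
    (∃ (i : Fin 3) (b : Bool), x = octVertex c (anchorFrame f u) ρ i b) ↔ ∃ (i : Fin 3) (b : Bool), x = octVertex c f ρ i b := by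
  constructor
  · rintro ⟨i, b, rfl⟩
    exact ⟨(anchorLab u (i, b)).1, (anchorLab u (i, b)).2, octVertex_anchorFrame c f ρ u (i, b)⟩
  · rintro ⟨i, b, rfl⟩
    refine ⟨(anchorInv u (i, b)).1, (anchorInv u (i, b)).2, ?_⟩
    have h := octVertex_anchorFrame c f ρ u (anchorInv u (i, b))
    rw [anchorLab_anchorInv] at h
    exact h.symm

/-- ★ **THE EXPLICIT ANCHORED FRAME VALUE (PROVED)**: if the octahedron `InOct P r₁ y z` of the ordered pole pair `(y, z) = (c ∓ ρ f_a, c ± ρ f_a)`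
of the frame `(c, f, ρ)` is exactly the six frame vertices, then `(τ·2ρ)²·F(W ∘ relabelled vertices)` is an anchored frame value of `(y, z)`. -/
theorem anchor_mem_frameValSet (F : (Fin 3 × Bool → ℝ) → ℝ) (τ : ℝ) (W : E3 → ℝ) {P : PeriodicConfiguration 3} {r₁ : ℝ} {c : E3}
    {f : Fin 3 → E3} {ρ : ℝ} (hf : Orthonormal ℝ f) (hρ : 0 < ρ) (a : Fin 3) (b : Bool)
    (hO : ∀ x, InOct P r₁ (octVertex c f ρ a (!b)) (octVertex c f ρ a b) x ↔ ∃ (i : Fin 3) (b' : Bool), x = octVertex c f ρ i b') :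
    (τ * (2 * ρ)) ^ 2 * F (fun p => W (octVertex c f ρ (anchorLab (a, b) p).1 (anchorLab (a, b) p).2)) ∈
      frameValSet F τ W P r₁ (octVertex c f ρ a (!b)) (octVertex c f ρ a b) := by
  obtain ⟨h1, h2⟩ := octVertex_anchorFrame_poles c f ρ a b
  refine ⟨c, anchorFrame f (a, b), ρ, anchorFrame_orthonormal hf (a, b), hρ, h1, h2, fun x => (hO x).trans
    (octVertex_anchorFrame_range c f ρ (a, b) x).symm, ?_⟩
  congr 2
  funext p
  rw [octVertex_anchorFrame]

/-- ★★ **`holeCost ≤` THE EXPLICIT-FRAME COST (PROVED)**: for a hole `w` of a cubic frame all of whose six ordered pole pairs span the lattice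
octahedron (`InOct` = the six vertices), the thawed hole cost (frame INFIMA) is at most the explicit-frame cost
`Σ_u (1/6)·max 0 ((τ·2ρ)²·F(W ∘ vertices ∘ anchorLab u))`. -/
theorem holeCost_le_anchored {τ r₁ : ℝ} {W : E3 → ℝ} {P : PeriodicConfiguration 3} {c₀ : E3} {f : Fin 3 → E3} {ρ : ℝ} {w : Fin 3 → ℤ}
    (hf : Orthonormal ℝ f) (hρ : 0 < ρ)
    (hO : ∀ (a : Fin 3) (b : Bool) (x : E3), InOct P r₁ (octVertex (cubicPt c₀ f ρ w) f ρ a (!b)) (octVertex (cubicPt c₀ f ρ w) f ρ a b) x ↔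
      ∃ (i : Fin 3) (b' : Bool), x = octVertex (cubicPt c₀ f ρ w) f ρ i b') :
    holeCost τ W P r₁ c₀ f ρ w ≤
      ∑ u : Fin 3 × Bool, (1 / 6) * max 0 ((τ * (2 * ρ)) ^ 2 * roofVal T75 (fun p => W (cubicPt c₀ f ρ (holeVertex w (anchorLab u p))))) := by
  unfold holeCost
  refine Finset.sum_le_sum fun u _ => mul_le_mul_of_nonneg_left (max_le (le_max_left _ _) ?_) (by norm_num)
  have hmem := anchor_mem_frameValSet (roofVal T75) τ W hf hρ u.1 u.2 (hO u.1 u.2)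
  have heq : (fun p : Fin 3 × Bool => W (octVertex (cubicPt c₀ f ρ w) f ρ (anchorLab (u.1, u.2) p).1 (anchorLab (u.1, u.2) p).2)) =
      fun p => W (cubicPt c₀ f ρ (holeVertex w (anchorLab u p))) := by
    funext p
    rw [lm_cubicPt_holeVertex]
  rw [heq] at hmem
  exact frameVal_le_of_mem hmem (le_max_right _ _) (le_max_left _ _)

end AnchoredFrames

/-! ## §90.3 The stencil dictionary: every hole descriptor depends on the depth field only through the seven stencil depths -/
section Stencil

variable {ρ : ℝ} {d₁ d₂ : (Fin 3 → ℤ) → ℝ} {w : Fin 3 → ℤ}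

/-- [formal bookkeeping] -/
theorem hDepthMin_congr (hv : ∀ u, d₁ (holeVertex w u) = d₂ (holeVertex w u)) : hDepthMin d₁ w = hDepthMin d₂ w := by
  unfold hDepthMin
  congr 1
  funext u
  exact hv u

/-- [formal bookkeeping] -/
theorem hKink_congr (h0 : d₁ w = d₂ w) (hv : ∀ u, d₁ (holeVertex w u) = d₂ (holeVertex w u)) (a : Fin 3) :
    hKink ρ d₁ w a = hKink ρ d₂ w a := by
  unfold hKink
  rw [← fc_holeVertex_true, ← fc_holeVertex_false, h0, hv, hv]

/-- [formal bookkeeping] -/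
theorem hMaxKink_congr (h0 : d₁ w = d₂ w) (hv : ∀ u, d₁ (holeVertex w u) = d₂ (holeVertex w u)) : hMaxKink ρ d₁ w = hMaxKink ρ d₂ w := by
  unfold hMaxKink
  congr 1
  funext a
  exact hKink_congr h0 hv a

/-- [formal bookkeeping] -/
theorem hAxis_congr (h0 : d₁ w = d₂ w) (hv : ∀ u, d₁ (holeVertex w u) = d₂ (holeVertex w u)) : hAxis ρ d₁ w = hAxis ρ d₂ w := by
  unfold hAxis
  rw [hKink_congr h0 hv, hKink_congr h0 hv, hMaxKink_congr h0 hv]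

/-- [formal bookkeeping] -/
theorem chargeDepth_congr (h0 : d₁ w = d₂ w) (hv : ∀ u, d₁ (holeVertex w u) = d₂ (holeVertex w u)) :
    chargeDepth ρ d₁ w = chargeDepth ρ d₂ w := by
  unfold chargeDepth
  rw [hAxis_congr h0 hv, ← fc_holeVertex_true, ← fc_holeVertex_false, hv, hv]

/-- [formal bookkeeping] -/
theorem feetHoleCost_congr (ϱ τ : ℝ) (hv : ∀ u, d₁ (holeVertex w u) = d₂ (holeVertex w u)) :
    feetHoleCost ϱ τ ρ d₁ w = feetHoleCost ϱ τ ρ d₂ w := by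
  unfold feetHoleCost
  refine Finset.sum_congr rfl fun u _ => ?_
  have h : (fun p => depthProfile ϱ (d₁ (holeVertex w (anchorLab u p)))) = fun p => depthProfile ϱ (d₂ (holeVertex w (anchorLab u p))) := by
    funext p
    rw [hv]
  rw [h]

/-- [formal bookkeeping] -/
theorem isFeetHole_congr (dK : ℝ) (h0 : d₁ w = d₂ w) (hv : ∀ u, d₁ (holeVertex w u) = d₂ (holeVertex w u)) :
    IsFeetHole dK ρ d₁ w ↔ IsFeetHole dK ρ d₂ w := by
  unfold IsFeetHole
  rw [hDepthMin_congr hv, hMaxKink_congr h0 hv]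

/-- [formal bookkeeping] -/
theorem sameDomino_congr {w' : Fin 3 → ℤ} (h0 : d₁ w = d₂ w) (hv : ∀ u, d₁ (holeVertex w u) = d₂ (holeVertex w u)) (h0' : d₁ w' = d₂ w')
    (hv' : ∀ u, d₁ (holeVertex w' u) = d₂ (holeVertex w' u)) : SameDomino ρ d₁ w w' ↔ SameDomino ρ d₂ w w' := by
  unfold SameDomino
  rw [hAxis_congr h0 hv, hAxis_congr h0' hv']

/-- The SEVEN-POINT STENCIL of the hole `w`: `w` and its six vertices `w ± eᵢ`. -/
def stencil (w : Fin 3 → ℤ) : Finset (Fin 3 → ℤ) := insert w (Finset.univ.image (holeVertex w))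

/-- [formal bookkeeping] -/
theorem mem_stencil_self (w : Fin 3 → ℤ) : w ∈ stencil w := Finset.mem_insert_self _ _

/-- [formal bookkeeping] -/
theorem mem_stencil_vertex (w : Fin 3 → ℤ) (u : Fin 3 × Bool) : holeVertex w u ∈ stencil w :=
  Finset.mem_insert_of_mem (Finset.mem_image_of_mem _ (Finset.mem_univ u))

/-- [formal bookkeeping] -/
theorem card_stencil_le (w : Fin 3 → ℤ) : (stencil w).card ≤ 7 := by
  unfold stencil
  refine (Finset.card_insert_le _ _).trans ?_
  have h := Finset.card_image_le (s := (Finset.univ : Finset (Fin 3 × Bool))) (f := holeVertex w)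
  rw [Finset.card_univ, Fintype.card_prod, Fintype.card_fin, Fintype.card_bool] at h
  omega

/-- ★ **THE FEET SET (PROVED)**: for a nonempty `C` and a finite set `T` of lattice indices, the nearest points (in `closure C`) of the lattice
points of `T` form a nonempty point obstacle `S` of at most `|T|` points whose lattice depth field agrees with that of `C` on `T`. -/
theorem feetSet_exists {C : Set E3} (hne : C.Nonempty) (c₀ : E3) (f : Fin 3 → E3) (ρ : ℝ) (T : Finset (Fin 3 → ℤ)) (hT : T.Nonempty) :
    ∃ S : Finset E3, S.Nonempty ∧ S.card ≤ T.card ∧ ∀ v ∈ T, latDepth (↑S) c₀ f ρ v = latDepth C c₀ f ρ v := by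
  have hex := fun v : Fin 3 → ℤ => Metric.exists_mem_closure_infDist_eq_dist hne (cubicPt c₀ f ρ v)
  choose q hq hqd using hex
  refine ⟨T.image q, hT.image q, Finset.card_image_le, fun v hv => ?_⟩
  have hmem : q v ∈ (↑(T.image q) : Set E3) := by
    rw [Finset.coe_image]
    exact Set.mem_image_of_mem q hv
  have hsub : (↑(T.image q) : Set E3) ⊆ closure C := by
    intro p hp
    rw [Finset.coe_image] at hp
    obtain ⟨v', -, rfl⟩ := hp
    exact hq v'
  unfold latDepth
  apply le_antisymm
  · calc Metric.infDist (cubicPt c₀ f ρ v) ↑(T.image q) ≤ dist (cubicPt c₀ f ρ v) (q v) := Metric.infDist_le_dist_of_mem hmem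
      _ = Metric.infDist (cubicPt c₀ f ρ v) C := (hqd v).symm
  · calc Metric.infDist (cubicPt c₀ f ρ v) C = Metric.infDist (cubicPt c₀ f ρ v) (closure C) := Metric.infDist_closure.symm
      _ ≤ Metric.infDist (cubicPt c₀ f ρ v) ↑(T.image q) := Metric.infDist_le_infDist_of_subset hsub ⟨q v, hmem⟩

end Stencil

end Summit.AtomisticToContinuum.Crystallization.Theorems.ChargedEnergyGapChartDial

end
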